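import Mathlib
import HarnessLib
import HarnessLib.Audit
import Summits.Schanuel.Statement
import Literature.NumberTheory.Transcendental.OneMotiveToric

/-!
Route: ToricPeriods

CLOSED (closed) 2026-08-15T10:42:11Z by planner-Schanuel-route-Schanuel-ToricPeriods-0 — reason: absorbed: reformulation fully machine-checked (X<=>Schanuel, GPC_toric<=>Schanuel), under floor, cone-blocked by operator Statement import; route-repair guardrail option (c) — note: CENSUS (route-repair 2026-08-15; full text: evidence CENSUS.md on this route). LINE: André GPC for toric 1-motives <=> Schanuel (Bertolin2002 Cor 1.3). TRIED/LANDED: object OneMotiveToric/.GPC/.ToricPeriodConjecture; GPC_toric<=>Schanuel = toricPeriodConjecture_iff_schanuel_holds (OneMotiveToric.lea. The file is kept as the record of this route; refuted decls are indexed as negative knowledge (`ledger negatives`).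

# Route Schanuel/ToricPeriods — André's generalised period conjecture for the 1-motive [ℤⁿ → 𝔾ₘ]

## Thesis X
Words: for x₁…xₙ ∈ ℂ with (2πi, x₁, …, xₙ) ℚ-linearly independent,
trdeg_ℚ ℚ(2πi, x, eˣ) ≥ n + 1. This is, verbatim, André's generalised period conjecture
"trdeg_ℚ k(periods of M) ≥ dim G_mot(M)" (Andre2004 §23.4.1; Bertolin2002 §1) for the toric 1-motive
M = [ℤⁿ → 𝔾ₘ], eᵢ ↦ e^{xᵢ}, over k = ℚ(e^{x₁},…,e^{xₙ}): its period matrix has entries 1, xᵢ, 2πi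
and
its motivic Galois (= Mumford–Tate) group is U ⋊ 𝔾ₘ with dim = dim_ℚ⟨2πi, x₁…xₙ⟩_ℚ.
Lean (elaborates; Mathlib only):
`∀ (n : ℕ) (x : Fin n → ℂ), LinearIndependent ℚ (Fin.cons (2 * ↑Real.pi * I) x) → ((n + 1 : ℕ) :
Cardinal) ≤ Algebra.trdeg ℚ ↥(IntermediateField.adjoin ℚ (insert (2 * ↑Real.pi * I) (Set.range x ∪
Set.range (cexp ∘ x))))`

## Assembly X → Schanuel
Elementary (staffable now): given z ℚ-independent, if (2πi, z) is independent apply X and drop 2πi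
(trdeg falls by ≤ 1); else after a GL_n(ℚ) change z₁ ∈ ℚ·2πi, e^{z₁} is a root of unity, apply X to
(z₂…zₙ). Conversely Schanuel ⇒ X (apply to (2πi, x), e^{2πi} = 1), so X ⟺ Schanuel (Bertolin2002
§3).

## Why this line (imports: motives, Tannakian period torsors — the "geometric/motivic lift")
It resolves PROBLEMS.md §3's flag on the Fresán–Jossen route: the exponential period conjecture
(FresanJossen2020) concerns the COUNTABLE ring of exponential periods over ℚ̄ and cannot reach ∀z ∈
ℂⁿ
(it yields e.g. alg. independence of e and π only); the motivic statement that IS equivalent to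
Schanuel is André's conjecture over an arbitrary base k ⊂ ℂ for toric 1-motives (Bertolin2002:
GPC_k(1-motives) ⇒ elliptico-toric conjecture ⊇ Schanuel). What the motivic side supplies:
(a) the k = ℚ̄ sector is Grothendieck's period conjecture for [ℤⁿ → 𝔾ₘ]/ℚ̄ = algebraic independence
of
logarithms of algebraic numbers (crux 2; only Baker's linear form known; its LINEAR shadow, the
Kontsevich–Zagier formal period conjecture for all 1-motives over ℚ̄, is a THEOREM,
HuberWustholz2022);
(b) an unconditional upper bound trdeg_k k(periods) ≤ dim G_mot and a period-torsor structure whose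
genericity over ℚ is the conjecture; (c) the function-field analogue is Ax1971 (proved), matching
route EclCore.

## Ranked cruxes
2. AlgIndepLogs: `∀ n (l : Fin n → ℂ), (∀ i, IsAlgebraic ℚ (cexp (l i))) → LinearIndependent ℚ l →
AlgebraicIndependent ℚ l`
   (Waldschmidt2000 Conj. 1.15; Lang1966) — hardest informative sector (k = ℚ̄).
3. 1-motive period formalism for toric M = [ℤʳ → 𝔾ₘⁿ]/k: periods generate k(2πi, log u_{ij}) and
   dim G_mot(M) = dim_ℚ⟨2πi, log u_{ij}⟩ — needs definitions (OneMotiveToric, its period field and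
   Mumford–Tate dimension); definition request filed toward Literature/NumberTheory/Transcendental.
4. Flagship instance: `AlgebraicIndependent ℚ ![Real.pi, Real.log 2]`.
5. Fact: HuberWustholz2022 Thm (linear relations of 1-periods over ℚ̄ are of motivic origin) ⇒
Baker.

## Kill criteria
X ⟺ Schanuel, so only a Schanuel counterexample kills; crux 2 refuted (algebraically dependent
ℚ-independent logarithms of algebraic numbers) kills X and Schanuel at once.

## Not decomposed yet
Elliptic/abelian part of Bertolin's conjecture; exponential motives; any use of (b) beyond
bookkeeping.

UNDER FLOOR: fewer than 2 cruxes remain after retriage (legacy route; D-0019).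

Novelty: NOVELTY (retriage audit 2026-08-14; searched: `lit search --hybrid "generalized period conjecture
1-motives Schanuel motivic Galois group"`, `lit frontier Schanuel --since 2015`, `lit bridges
Schanuel --cross any`, barrier catalogue Literature/Barriers/Schanuel/*). Nearest prior art:
Bertolin2002, Cor. 1.3 and §3.5 — "pour les 1-motifs sans partie abélienne, (CPG)_K est équivalente
à la conjecture de Schanuel": this IS thesis X together with its assembly, and both directions are
now kernel-checked in tree
(Literature.NumberTheory.Transcendental.toricPeriodConjecture_iff_schanuel_holds; Schanuel → X as
Literature.Periods.schanuel_imp_toric_gpc_thesis); Andre2004 §23.4.1 and André's letter in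
Bertolin2020 = arXiv:1905.07247 ("the case of 1-motives without abelian part, in which case one
recovers Schanuel's conjecture"; "inequality ≤ is unconditional" = support item
ToricTrdegLeMotGaloisDim). The same dictionary has since been extended, always as conjecture ⟺
conjecture: semi-abelian and abelian analogues of Schanuel = GPC for general 1-motives
(arXiv:2010.15170, arXiv:1811.05167), Schanuel-style semi-elliptic conjectures ⟺ GPC for 1-motives
with elliptic abelian part (arXiv:2509.08700, arXiv:2504.14048), dim G_mot of a 1-motive over ℂ and
a reformulated GPC (arXiv:2604.24128). What is PROVED nearby lives one level down or sideways: the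
ℚ̄-LINEAR period conjecture for all 1-motives (HuberWustholz2022, Thm 1.3 = Thm 9.10), the
FUNCTIONAL André–Grothendieck period conjecture over  [refs: 1905.07247, 2010.15170, 1811.05167, 2509.08700, 2504.14048, 2604.24128, 2208.05182, math/0506078, Bertolin2002, Andre2004, Bertolin2020, HuberWustholz2022, FresanJossen2020]

Barriers (technique_class: grothendieck-period-conjecture andre-gpc-over-k one-motives): BARRIERS (technique_class: grothendieck-period-conjecture andre-gpc-over-k one-motives).
- Literature.Barriers.Schanuel.PeriodConjectureOverQbarScope: NOT evaded — instantiated. Its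
conjunct (vi) is this route's thesis/assembly (toric GPC over arbitrary k ⊆ ℂ ⟺ Schanuel,
Literature.NumberTheory.Transcendental.toricPeriodConjecture_iff_schanuel_holds), and its conjunct
(i) (Literature.Barriers.Schanuel.toricPeriodConjectureQbar_iff_algIndepLogarithms) shows that the
only sector with content of its own, k ⊆ ℚ̄, is exactly crux AlgIndepLogs, whose periods lie in the
countable ℚ-space 𝓛 = exp⁻¹(ℚ̄) ∌ 1 (conjuncts (ii)–(iv)); so nothing proved toward the period
conjectures over ℚ̄ (HuberWustholz2022 Thm 1.3, Kontsevich–Zagier) reaches X or even the Schanuel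
tuple (1, 2πi) ("these conjectures (conjecturally) do not imply SC as, conjecturally, e is not a
period", Pila2022 §13.6 p. 94). The bet would have to be a numerical input valid for transcendental
k (genericity of the period torsor in André's (?!); exponential motives, FresanJossen2020) — none
exists in print; the route does not supply one.
- Literature.Barriers.Schanuel.AlgebraicIndependenceOfLogarithms: applies verbatim (strength
barrier) — crux AlgIndepLogs is that statement (Literature.Barriers.Schanuel.AlgIndepLogarithms);
any proof exhibits two algebraically independent logarithms of algebraic numbers (open, Roy1992 p.
22; Literature.Barriers.Schanuel.algebraicIndependent_piI_log_two_of_algIndepLogarithms = support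
item P

History (route lifecycle, newest last):
- 2026-08-15T10:42:11Z · CLOSED closed — absorbed: reformulation fully machine-checked (X<=>Schanuel, GPC_toric<=>Schanuel), under floor, cone-blocked by operator Statement import; route-repair guardrail option (c) (planner-Schanuel-route-Schanuel-ToricPeriods-0)

sub-problem: Schanuel · status: closed(closed) · opened planner-Schanuel-Survey-0 2026-08-13T06:03:33Z · rev 1 · ledger route-Schanuel-ToricPeriods
GENERATED by the gate from the ledger (D-0016/17). Provers cite these decls: `theorem foo : Summit.Schanuel.Schanuel.Theses.ToricPeriods.<Decl> := …` in Summits/Schanuel/Schanuel/Theorems/<Name>.lean.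
-/

namespace Summit.Schanuel.Schanuel.Theses.ToricPeriods

open scoped BigOperators Topology Manifold Classical MeasureTheory ProbabilityTheory Matrix InnerProductSpace ComplexConjugate ContinuousMap
open Filter Set Function TopologicalSpace MeasureTheory

attribute [summit_statement] _root_.Schanuel

open Literature.Periods

/-- item stmt-Schanuel-0081 · target · rank 0 · closed · moot by None · by planner
why it might fail: X ⟺ Schanuel (Schanuel→X formal: Literature.Periods.schanuel_imp_toric_gpc_thesis; X→Schanuel elementary, Bertolin2002 §3.5 (A), item 0082): no attack surface independent of the summit — fails iff Schanuel fails; already its n=1 instance x=log 2 (π, log 2 alg. independent) is open (Roy1992 p. 22).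
sources: Bertolin2002, Cor. 1.3 and §3.5, Andre2004, §23.4.1, Bertolin2020 = arXiv:1905.07247, appendix (letter of Y. André), (?!), Literature.Periods.schanuel_imp_toric_gpc_thesis (Summits/Schanuel/Schanuel/Theorems/ToricPeriodsAssembly.lean), Literature.NumberTheory.Transcendental.toricPeriodConjecture_iff_schanuel_holds (Literature/NumberTheory/Transcendental/OneMotiveToric.lean), Roy1992, Introduction p. 22
For (2πi, x₁..xₙ) ℚ-independent, trdeg ℚ(2πi, x, e^x) ≥ n+1. Verbatim André's GPC_k 'trdeg_ℚ
k(periods M) ≥ dim G_mot(M)' for the toric 1-motive M=[ℤⁿ→𝔾ₘ], e_i ↦ e^{x_i}, k = ℚ(e^x): periods 1,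
x_i, 2πi; dim MT(M) = dim_ℚ⟨2πi,x⟩. Equivalent to Schanuel (Bertolin2002 §3). Sources: Andre2004
§23.4, Bertolin2002, Lang1966. -/
@[route_item "route-Schanuel-ToricPeriods"]
def ToricGpcThesis : Prop :=
  ∀ (n : ℕ) (x : Fin n → ℂ), LinearIndependent ℚ (Fin.cons (2 * ↑Real.pi * Complex.I) x) → ((n + 1 : ℕ) : Cardinal) ≤ Algebra.trdeg ℚ ↥(IntermediateField.adjoin ℚ (insert (2 * ↑Real.pi * Complex.I) (Set.range x ∪ Set.range (Complex.exp ∘ x))))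

/-- item stmt-Schanuel-0083 · crux · rank 2 · closed · moot by None · by planner
why it might fail: Open for every n≥2: no two logs of algebraic numbers are known alg. independent (Roy1992 p.22); Baker = degree 1 only. A ℚ-independent point of xy=z² in 𝓛³ (¬four exponentials; provably out of reach of the linear-subgroup method, Roy1995 §3.2) would refute it and Schanuel at once.
sources: Waldschmidt2000, §1.4 Conj. 1.15, Waldschmidt2005, §1 Conj. 1.1, Pila2022, Ch. 13 Conj. 13.5 and §13.6 p. 94, Roy1992, Introduction p. 22, Roy1995, §3.2 p. 65, Baker1975, Thm 2.1
Waldschmidt2000 Conjecture 1.15 (alg. independence of logarithms); only the degree-1 part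
(Baker1966: linear independence over ℚ̄ of 1,l₁..lₙ) is known. 2πi counts as a logarithm
(e^{2πi}=1). Follows from Schanuel; it is GPC over ℚ̄ for [ℤⁿ→𝔾ₘ]. Sources: Waldschmidt2000 §1.4,
Lang1966, Andre2004 §23, HuberWustholz2022. -/
@[route_item "route-Schanuel-ToricPeriods"]
def AlgIndepLogs : Prop :=
  ∀ (n : ℕ) (l : Fin n → ℂ), (∀ i, IsAlgebraic ℚ (Complex.exp (l i))) → LinearIndependent ℚ l → AlgebraicIndependent ℚ l

/-- item stmt-Schanuel-0087 · support · rank 3 · closed · moot by None · by planner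
sources: Bertolin2002, §3, Literature.NumberTheory.Transcendental.OneMotiveToric.span_periodSet_le (Literature/NumberTheory/Transcendental/OneMotiveToric.lean)
For k ⊆ ℂ a subfield and u : Fin r → Fin n → kˣ, the 1-motive M = [ℤʳ → 𝔾ₘⁿ] has: (i) period field
k(P(M)) = k(2πi, log u_ij) (any branch), (ii) dim G_mot(M) = dim MT(M) = dim_ℚ span_ℚ(2πi, log u_ij
: i,j), (iii) unconditional bound trdeg_k k(P(M)) ≤ dim G_mot(M). Then André's GPC_k for M reads
trdeg_ℚ k(2πi, log u_ij) ≥ dim_ℚ⟨2πi, log u_ij⟩, and #0 is the case n=1, k=ℚ(u). Needs definitions: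
toric 1-motive, its Betti/de Rham realisations or directly its period matrix, Mumford–Tate group.
Sources: Bertolin2002 §§1–3, Andre2004 §§7, 23, HuberWustholz2022 Part II. [needs_definition:
OneMotiveToric] -/
@[route_item "route-Schanuel-ToricPeriods"]
def ToricOneMotivePeriodFormalism : Prop :=
  ∀ (k : IntermediateField ℚ ℂ) (r n : ℕ) (M : Literature.NumberTheory.Transcendental.OneMotiveToric k r n), n ≠ 0 → M.periodFieldOver = IntermediateField.adjoin (↥k) (insert (2 * ↑Real.pi * Complex.I) (Set.range fun p : Fin r × Fin n => Complex.log (M.u p.1 p.2))) ∧ Submodule.span ℚ M.periodSet = Submodule.span ℚ (insert (2 * ↑Real.pi * Complex.I) (Set.range fun p : Fin r × Fin n => Complex.log (M.u p.1 p.2)))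

/-- item stmt-Schanuel-0467 · support · rank 3 · closed · moot by None · by planner
sources: Bertolin2002, Cor. 1.3 (proof §3.5), Literature.NumberTheory.Transcendental.toricPeriodConjecture_iff_schanuel_holds (Literature/NumberTheory/Transcendental/OneMotiveToric.lean)
Typed supersession of stmt-Schanuel-0087 now that defn-OneMotiveToric is in tree
(Literature/NumberTheory/Transcendental/OneMotiveToric.lean). Prove the named fact
Literature.NumberTheory.Transcendental.toricPeriodConjecture_iff_schanuel: ToricPeriodConjecture
(forall k r n (M : OneMotiveToric k r n), M.GPC) iff Schanuel (RHS is verbatim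
Literature.Periods.SchanuelConjecture, Iff.rfl). (<=) pick a Q-basis B of span_Q M.periodSet inside
periodSet (finite-dim by finiteDimensional_span_periodSet), exp(B) in {1} u {u i j} subset k, apply
Schanuel to B, compare trdeg_Q k(periods) >= trdeg_Q Q(B, exp B) >= #B = motGaloisDim. (=>) given z
Q-lin.indep in C^n, take k = Q(exp z_1..exp z_n) as IntermediateField.adjoin, M = [Z -> Gm^n] with u
0 j = exp(z j); GPC gives trdeg_Q k(2 pi i, all logs) >= dim span_Q(2 pi i, z) in {n, n+1}; remove 2
pi i (trdeg drops by <= 1) with the GL_n(Q) case split when 2 pi i in span_Q z. Elementary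
bookkeeping, est. 300-400 lines; staffable now. Sketch: routes/ToricPeriods/Sketch2.lean rc0.
Sources: Bertolin2002 Cor 1.3 and sec. 3; Andre2004 sec. 23.4. -/
@[route_item "route-Schanuel-ToricPeriods"]
def ToricBertolinCorDischarge : Prop :=
  Literature.NumberTheory.Transcendental.toricPeriodConjecture_iff_schanuel

/-- item stmt-Schanuel-0088 · support · rank 4 · closed · moot by None · by planner
why it might fail: OPEN: 'it is not even known whether or not there exist two elements of L which are algebraically independent over ℚ' (Roy1992 p.22); irrationality of π·log 2 open (π+log 2 transcendental by Baker). No counterexample short of ¬Schanuel.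
sources: Roy1992, Introduction p. 22, Waldschmidt2000, §1.4, Literature.Barriers.Schanuel.algebraicIndependent_piI_log_two_of_algIndepLogarithms (ℂ-version (πi, log 2) from AlgIndepLogs; ℝ→ℂ transfer + scaling by I ~40 lines)
Open; not even known that π·log 2 or π + log 2 is irrational... (transcendence of each is Lindemann
/ Hermite–Lindemann). Instance of #2 and of Schanuel n=2 with x = (πi, log 2). Sources:
Waldschmidt2000 §1.4, Lang1966. -/
@[route_item "route-Schanuel-ToricPeriods"]
def PiLogTwoAlgIndep : Prop :=
  AlgebraicIndependent ℚ ![Real.pi, Real.log 2]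

/-- item stmt-Schanuel-0469 · support · rank 5 · closed · moot by None · by planner
sources: Bertolin2020 = arXiv:1905.07247, letter of Y. André, Remark ('inequality ≤ is unconditional'), Bertolin2002, p. 205, Literature.NumberTheory.Transcendental.trdeg_adjoin_insert_le / Literature.NumberTheory.Transcendental.isAlgebraic_adjoin_preimage (OneMotiveToric.lean)
Discharge the named fact (toric case of the Deligne/Andre period-torsor inequality, unconditional):
for M : OneMotiveToric k r n, Algebra.trdeg k M.periodFieldOver <= M.motGaloisDim. Proof: every
period is a Q-combination of a Q-basis B subset periodSet of span_Q periodSet (span_periodSet_le),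
so k(periods M) = k(B) is generated over k by #B = motGaloisDim elements, hence trdeg_k <= #B
(Algebra.trdeg of adjoin of a finite set <= its cardinality; IsTranscendenceBasis exists inside a
generating set). Elementary, est. 150-250 lines; staffable now; validates the OneMotiveToric
encoding (refutation => definition bug). Sketch: routes/ToricPeriods/Sketch2.lean rc0. Sources:
Bertolin2020 (arXiv:1905.07247) letter of Andre, remark on unconditional inequality; Andre2004 sec.
23.4. -/
@[route_item "route-Schanuel-ToricPeriods"]
def ToricTrdegLeMotGaloisDim : Prop :=
  Literature.NumberTheory.Transcendental.trdeg_periodFieldOver_le_motGaloisDim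

/-- item stmt-Schanuel-0082 · assembly · rank 1 · closed · moot by None · by planner
Elementary, staffable now: if (2πi,z) independent apply X and drop 2πi (adjoining one element raises
trdeg by ≤ 1); else GL_n(ℚ)-change so z₁ ∈ ℚ·2πi (e^{z₁} a root of unity, algebraic) and apply X to
(z₂..zₙ). Needs GL_n(ℚ)-invariance of the Schanuel bound. Sources: Bertolin2002 §3. -/
@[route_item "route-Schanuel-ToricPeriods"]
def Assembly : Prop :=
  (∀ (n : ℕ) (x : Fin n → ℂ), LinearIndependent ℚ (Fin.cons (2 * ↑Real.pi * Complex.I) x) → ((n + 1 : ℕ) : Cardinal) ≤ Algebra.trdeg ℚ ↥(IntermediateField.adjoin ℚ (insert (2 * ↑Real.pi * Complex.I) (Set.range x ∪ Set.range (Complex.exp ∘ x))))) → Schanuel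

/-- item stmt-Schanuel-0468 · assembly · rank 1 · closed · moot by None · by planner
Assembly through the 1-motive object: with the Bertolin Cor 1.3 fact as hypothesis, GPC for all
toric 1-motives implies Schanuel. One line: Schanuel unfolds to
Literature.Periods.SchanuelConjecture which is syntactically the RHS of the fact (Iff.rfl / exact
h.1). Complements stmt-Schanuel-0082 (explicit r=1 assembly). Sketch:
routes/ToricPeriods/Sketch2.lean rc0. Sources: Bertolin2002 Cor 1.3. -/
@[route_item "route-Schanuel-ToricPeriods"]
def Assembly2 : Prop :=
  Literature.NumberTheory.Transcendental.toricPeriodConjecture_iff_schanuel → Literature.NumberTheory.Transcendental.ToricPeriodConjecture → Schanuel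

end Summit.Schanuel.Schanuel.Theses.ToricPeriods
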